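import Summits.Ventures.Crystal3D.Bulk.LocalTwelve
import HarnessLib

/-!
# The trivial constant floor `K ≥ 12^{1/3}` for `BulkCrystallization3D K`

HONEST FRAMING. Part of the venture `Summits/Ventures/Crystal3D` (cell `pub-crystal3d`, phase 2; sub-cell
`crystal3d-paper`, HUMAN RULING D-0044; lead RULING #234 (4): «P7 — YES, optional, constant floor»; desk scratch by
crystal3d-writer g2 `enclosure/BulkConstantFloor.scratch.lean` c25275922127a06a, filed by p2 g18 with the `_scratch`
suffixes dropped). This file asserts NOTHING about whether `BulkCrystallization3D K` holds for any `K`; it is a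
sharpness-side remark on the CONSTANT, and says nothing about large `N` (the content of the statement is the
`N^{2/3}` count for every `N`). Nothing here concerns GAP(1.26), the census, or the K25 lane; no existing declaration
is touched or restated.

The remark: in ANY packing of `N = 12` unit balls no ball has twelve contacts (a ball has at most `N − 1 = 11`
contact neighbours), so every ball is a defect, `#nonClosePacked x = 12`, and `BulkCrystallization3D K` at a twelve-ball
sticky ground state (which exists: `exists_numContacts_eq_maxContacts`) reads `12 ≤ K · 12^{2/3}`, i.e.
`K ≥ 12^{1/3} ≈ 2.289`. This sharpens the constant side of `le_of_bulkCrystallization3D` (`K ≥ 167/600 ≈ 0.278`,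
`Bulk/BulkExponentSharp.lean`, from `N = 2`) by a factor `≈ 8`. Closure: standard axioms.

Contents: `coordination_le_pred`, `nonClosePacked_eq_univ_of_le_twelve`, `rpow_twelve_le_of_bulkCrystallization3D`,
`not_bulkCrystallization3D_of_lt_rpow_twelve`, `lt_rpow_twelve` (`2.289 < 12^{1/3}`).
-/

noncomputable section

open Finset

namespace Summit.Ventures.Crystal3D

open Literature.Geometry.DiscreteGeometry

variable {N : ℕ}

/-- A ball of an `N`-ball configuration has at most `N − 1` contact neighbours. -/
theorem coordination_le_pred (x : Fin N → EuclideanSpace ℝ (Fin 3)) (i : Fin N) :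
    coordination x i ≤ N - 1 := by
  classical
  have hsub : contactNeighbors x i ⊆ univ.erase i := by
    intro j hj
    rw [mem_contactNeighbors] at hj
    exact mem_erase.2 ⟨hj.1, mem_univ j⟩
  calc coordination x i = (contactNeighbors x i).card := rfl
    _ ≤ (univ.erase i).card := card_le_card hsub
    _ = N - 1 := by rw [card_erase_of_mem (mem_univ i), card_univ, Fintype.card_fin]

/-- In a unit packing of `N ≤ 12` balls every ball is a defect: `nonClosePacked x = univ`
(a close-packed shell needs twelve contact neighbours, and a ball has at most `N − 1 ≤ 11`). -/
theorem nonClosePacked_eq_univ_of_le_twelve (hN : N ≤ 12) {x : Fin N → EuclideanSpace ℝ (Fin 3)}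
    (hx : IsUnitPacking x) : nonClosePacked x = univ := by
  classical
  ext i
  simp only [mem_nonClosePacked, mem_univ, iff_true]
  intro h
  have h12 := h.coordination_eq hx
  have hle := coordination_le_pred x i
  omega

/-- **`BulkCrystallization3D K` forces `K ≥ 12^{1/3}`**: at a twelve-ball sticky ground state all twelve balls
are defects, so the statement reads `12 ≤ K · 12^{2/3}`. -/
theorem rpow_twelve_le_of_bulkCrystallization3D {K : ℝ} (hB : BulkCrystallization3D K) :
    (12 : ℝ) ^ ((1 : ℝ) / 3) ≤ K := by
  classical
  obtain ⟨x, hx, hxe⟩ := exists_numContacts_eq_maxContacts (d := 3) (N := 12) (by norm_num)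
  have hgs : IsStickyGroundState x := by
    unfold IsStickyGroundState
    exact ⟨hx, hxe⟩
  have h1 := hB 12 x hgs
  rw [nonClosePacked_eq_univ_of_le_twelve le_rfl hx, card_univ, Fintype.card_fin] at h1
  -- `h1 : (12 : ℝ) ≤ K * 12 ^ (2/3)`; divide by `12^{2/3}` and use `12 = 12^{1/3} · 12^{2/3}`
  have hpos : (0 : ℝ) < (12 : ℝ) ^ ((2 : ℝ) / 3) := by positivity
  have hsplit : (12 : ℝ) = (12 : ℝ) ^ ((1 : ℝ) / 3) * (12 : ℝ) ^ ((2 : ℝ) / 3) := by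
    rw [← Real.rpow_add (by norm_num : (0 : ℝ) < 12)]; norm_num
  have h2 : (12 : ℝ) ^ ((1 : ℝ) / 3) * (12 : ℝ) ^ ((2 : ℝ) / 3) ≤ K * (12 : ℝ) ^ ((2 : ℝ) / 3) := by
    have h1' : ((12 : ℕ) : ℝ) ≤ K * ((12 : ℕ) : ℝ) ^ ((2 : ℝ) / 3) := h1
    push_cast at h1'
    linarith [hsplit]
  exact le_of_mul_le_mul_right h2 hpos

/-- **`BulkCrystallization3D K` is false for every `K < 12^{1/3} ≈ 2.289`.** -/
theorem not_bulkCrystallization3D_of_lt_rpow_twelve {K : ℝ} (hK : K < (12 : ℝ) ^ ((1 : ℝ) / 3)) :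
    ¬ BulkCrystallization3D K :=
  fun hB => not_le.2 hK (rpow_twelve_le_of_bulkCrystallization3D hB)

/-- Numerically: `2.289 < 12^{1/3}` (since `2.289³ = 11.993… < 12`), so every `K ≤ 2.289` fails. -/
theorem lt_rpow_twelve : (2.289 : ℝ) < (12 : ℝ) ^ ((1 : ℝ) / 3) := by
  have h : (2.289 : ℝ) = ((2.289 : ℝ) ^ (3 : ℝ)) ^ ((1 : ℝ) / 3) := by
    rw [← Real.rpow_mul (by norm_num)]; norm_num
  rw [h]
  exact Real.rpow_lt_rpow (by positivity) (by norm_num) (by norm_num)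

/-- Corollary in the shape of `not_bulkCrystallization3D_of_lt` (`Bulk/BulkExponentSharp.lean`, constant `167/600`):
`BulkCrystallization3D K` fails for every `K ≤ 2.289`. -/
theorem not_bulkCrystallization3D_of_le_2289 {K : ℝ} (hK : K ≤ 2.289) : ¬ BulkCrystallization3D K :=
  not_bulkCrystallization3D_of_lt_rpow_twelve (lt_of_le_of_lt hK lt_rpow_twelve)

end Summit.Ventures.Crystal3D

end
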